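import Summits.Ventures.HSemireg.WedgeHankelRecurrenceGaussExistence

/-!
# Venture HSemireg — **WENDROFF'S THEOREM (full)**: ANY two strictly interlacing real point sets `x_0 < w_0 < x_1 < ⋯ < w_{n−1} < x_n` are the zeros of two CONSECUTIVE members `q_n`,
# `q_{n+1}` of a positive three-term recurrence `q_{k+2} = (X − a_{k+1}) q_{k+1} − b_{k+1} q_k`, `b_j > 0` (N282's step iterated down to degree `0`, with the top coefficients spliced in);
# hence both are orthogonal polynomials of one positive discrete measure (Favard, N280), and EVERY monic real polynomial with simple real zeros is an orthogonal polynomial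

HONEST FRAMING. Part of the Lean index of the computation cell `pub-hsemireg` (seat p10 gen 43, Sunday typer «UNIFORM-IN-n»).  Real polynomials and finite sums only (recurrence-defined
sequences via `Nat.rec` inside the proofs); no variety, no cohomology theory, no sheaf, no Ext group and no semiregularity map is constructed here; nothing here says that HC / HC_CM / HC_AV
holds; no Literature fact (unproved `Prop`) is declared or used.  Custodian versions as in `WedgeHankelSiegelIdeal` (1/3).
SOURCES (cited).  B. Wendroff, *On orthogonal polynomials*, Proc. Amer. Math. Soc. 12 (1961) 554–555 (the theorem: two polynomials with simple real interlacing zeros are consecutive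
members of an orthogonal sequence); T. S. Chihara, *An Introduction to Orthogonal Polynomials* (1978), Ch. I Ex. 5.10 and Thm 4.4 (Favard); J. Favard, C. R. Acad. Sci. Paris 200 (1935)
2052–2053; G. Szegő, *Orthogonal Polynomials*, §3.3.
PROOF TYPED HERE.  Induction on `n` for the sizes `(n + 1, n)`: N282 `wendroff_step` writes `∏(X − x_i) = (X − a′) ∏(X − w_k) − b′ ∏(X − v_k)` with `b′ > 0` and `v` interlacing `w`; the
induction hypothesis gives a positive recurrence with `q_{n} = ∏(X − v)`, `q_{n+1} = ∏(X − w)`; `recurrence_modify_top` replaces `(a_{n+1}, b_{n+1})` by `(a′, b′)` and regenerates the tail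
(`exists_recurrence_solution`, a `Nat.rec` pair sequence as in N291), so that `q_{n+2} = ∏(X − x)`.  Base `n = 0`: `q_0 = 1`, `q_1 = X − x_0`.  The measure is N280 `favard_finite` + N285
`orthogonal_lower_of_pairwise`; for a single point set, the midpoints serve as the interlacing partner.
DEDUP DISCLOSURE (`rg -n 'wendroff|exists_recurrence_solution|recurrence_modify_top|recurrence_agree' Summits Literature`, 2026-09-03): only N282 (`wendroff_step`, `wendroff_step_eval`,
one step).  The 7 names below: 0 hits tree-wide.

WHAT IS IN THE TREE.  N282 `wendroff_step`; N279 `recurrence_monic_natDegree`; N280 `favard_finite`; N285 `orthogonal_lower_of_pairwise`; Mathlib `Function.update`, `Nat.rec`.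
THIS FILE (namespace `Summit.Ventures.HSemireg.Wedge.HankelOuter` continued; CHAINED on N291 (import), N282, N280, N285; 0 definitions):
* §1057 `exists_recurrence_solution` (every coefficient pair `(a, b)` and initial pair `(P₀, P₁)` generate a solution `ℕ → ℝ[X]`), `recurrence_agree_of_coeff_agree` (solutions with the same
  initial pair and the same coefficients at indices `1, …, N` agree up to index `N + 1`), `recurrence_modify_top` (replace `(a_{N+1}, b_{N+1})`, keep `q_0, …, q_{N+1}`, prescribe `q_{N+2}`),
  **`wendroff_recurrence`** (THE THEOREM, sizes `(n + 1, n)`), `wendroff_recurrence_succ` (sizes `(n + 2, n + 1)`, the hypotheses of N282), **`exists_orthogonality_measure_of_interlace`**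
  (WENDROFF: a positive discrete measure with `n + 2` atoms making BOTH `∏(X − w_k)` and `∏(X − x_i)` orthogonal to all lower degrees), `exists_positive_recurrence_of_strictMono` (every
  `∏(X − x_i)` with `x` strictly increasing is a `q_{n+1}` of a positive recurrence).
CAVEATS.  The measure produced is ONE of infinitely many (the tail coefficients are free).  Nothing Ext-side.  New names only.
-/

open Module Polynomial
open scoped Matrix Polynomial

namespace Summit.Ventures.HSemireg.Wedge.HankelOuter

/-! ## §1057. Wendroff's theorem (full) -/

/-- **Every recurrence has a solution with prescribed initial pair**: for `a b : ℕ → ℝ` and `P₀ P₁ : ℝ[X]` there is `Q : ℕ → ℝ[X]` with `Q 0 = P₀`, `Q 1 = P₁`,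
`Q (k+2) = (X − a_{k+1}) Q (k+1) − b_{k+1} Q k`. [mechanism (`Nat.rec` on pairs); this file, §1057] -/
theorem exists_recurrence_solution (a b : ℕ → ℝ) (P₀ P₁ : ℝ[X]) :
    ∃ Q : ℕ → ℝ[X], Q 0 = P₀ ∧ Q 1 = P₁ ∧ ∀ k, Q (k + 2) = (Polynomial.X - C (a (k + 1))) * Q (k + 1) - C (b (k + 1)) * Q k := by
  set F : ℕ → ℝ[X] × ℝ[X] := fun k => Nat.rec (motive := fun _ => ℝ[X] × ℝ[X]) (P₀, P₁)
    (fun k p => (p.2, (Polynomial.X - C (a (k + 1))) * p.2 - C (b (k + 1)) * p.1)) k with hF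
  have hF0 : F 0 = (P₀, P₁) := rfl
  have hFs : ∀ k, F (k + 1) = ((F k).2, (Polynomial.X - C (a (k + 1))) * (F k).2 - C (b (k + 1)) * (F k).1) := fun k => rfl
  refine ⟨fun k => (F k).1, by simp only [hF0], by simp only [hFs, hF0], fun k => ?_⟩
  simp only
  rw [show k + 2 = (k + 1) + 1 by ring, hFs (k + 1), hFs k]

/-- **Solutions are determined by the initial pair and the coefficients used so far**: if `q`, `q′` solve recurrences with coefficients `(a, b)`, `(a′, b′)`, `q 0 = q′ 0`, `q 1 = q′ 1`,
and `a′_k = a_k`, `b′_k = b_k` for `1 ≤ k ≤ N`, then `q′_k = q_k` for all `k ≤ N + 1`. [mechanism; this file, §1057] -/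
theorem recurrence_agree_of_coeff_agree {a b a' b' : ℕ → ℝ} {q q' : ℕ → ℝ[X]} (hq0 : q' 0 = q 0) (hq1 : q' 1 = q 1)
    (hrec : ∀ k, q (k + 2) = (Polynomial.X - C (a (k + 1))) * q (k + 1) - C (b (k + 1)) * q k)
    (hrec' : ∀ k, q' (k + 2) = (Polynomial.X - C (a' (k + 1))) * q' (k + 1) - C (b' (k + 1)) * q' k)
    {N : ℕ} (ha : ∀ k, 1 ≤ k → k ≤ N → a' k = a k) (hb : ∀ k, 1 ≤ k → k ≤ N → b' k = b k) :
    ∀ k, k ≤ N + 1 → q' k = q k := by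
  have key : ∀ k, (k ≤ N + 1 → q' k = q k) ∧ (k + 1 ≤ N + 1 → q' (k + 1) = q (k + 1)) := by
    intro k
    induction k with
    | zero => exact ⟨fun _ => hq0, fun _ => hq1⟩
    | succ k ih =>
      refine ⟨ih.2, fun hk => ?_⟩
      rw [show k + 1 + 1 = k + 2 by ring, hrec' k, hrec k, ih.1 (by omega), ih.2 (by omega), ha (k + 1) (by omega) (by omega),
        hb (k + 1) (by omega) (by omega)]
  exact fun k hk => (key k).1 hk

/-- **Splicing the top coefficients**: given a recurrence `(a, b, q)` with `q_0 = 1`, `q_1 = X − a_0`, an index `N` and new values `a′, b′`, there is a recurrence `(A, B, Q)` with `Q_0 = 1`,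
`Q_1 = X − A_0`, `B_j = b_j` for `j ≠ N + 1`, `B_{N+1} = b′`, `Q_k = q_k` for `k ≤ N + 1`, and `Q_{N+2} = (X − a′) q_{N+1} − b′ q_N`. [mechanism (Wendroff's iteration); this file, §1057] -/
theorem recurrence_modify_top {a b : ℕ → ℝ} {q : ℕ → ℝ[X]} (hq0 : q 0 = 1) (hq1 : q 1 = Polynomial.X - C (a 0))
    (hrec : ∀ k, q (k + 2) = (Polynomial.X - C (a (k + 1))) * q (k + 1) - C (b (k + 1)) * q k) (N : ℕ) (a' b' : ℝ) :
    ∃ (A B : ℕ → ℝ) (Q : ℕ → ℝ[X]), Q 0 = 1 ∧ Q 1 = Polynomial.X - C (A 0) ∧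
      (∀ k, Q (k + 2) = (Polynomial.X - C (A (k + 1))) * Q (k + 1) - C (B (k + 1)) * Q k) ∧
      (∀ j, j ≠ N + 1 → B j = b j) ∧ B (N + 1) = b' ∧ (∀ k, k ≤ N + 1 → Q k = q k) ∧
      Q (N + 2) = (Polynomial.X - C a') * q (N + 1) - C b' * q N := by
  set A : ℕ → ℝ := Function.update a (N + 1) a' with hA
  set B : ℕ → ℝ := Function.update b (N + 1) b' with hB
  obtain ⟨Q, hQ0, hQ1, hQrec⟩ := exists_recurrence_solution A B (q 0) (q 1)
  have hA0 : A 0 = a 0 := by rw [hA, Function.update_of_ne (by omega)]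
  have hagree : ∀ k, k ≤ N + 1 → Q k = q k :=
    recurrence_agree_of_coeff_agree hQ0 hQ1 hrec hQrec (fun k _ hk => by rw [hA, Function.update_of_ne (by omega)])
      (fun k _ hk => by rw [hB, Function.update_of_ne (by omega)])
  refine ⟨A, B, Q, by rw [hQ0, hq0], by rw [hQ1, hq1, hA0], hQrec, fun j hj => by rw [hB, Function.update_of_ne hj], by rw [hB, Function.update_self],
    hagree, ?_⟩
  rw [hQrec N, hagree (N + 1) le_rfl, hagree N (by omega), hA, hB, Function.update_self, Function.update_self]

/-- **WENDROFF'S THEOREM.**  If `x_0 < w_0 < x_1 < ⋯ < w_{n−1} < x_n` (`x : Fin (n+1) → ℝ`, `w : Fin n → ℝ` strictly increasing and interlacing), then there is a positive three-term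
recurrence `q_0 = 1`, `q_1 = X − a_0`, `q_{k+2} = (X − a_{k+1}) q_{k+1} − b_{k+1} q_k`, all `b_j > 0`, with `q_n = ∏_k (X − w_k)` and `q_{n+1} = ∏_i (X − x_i)`.
[Wendroff 1961; Chihara I Ex. 5.10; this file, §1057] -/
theorem wendroff_recurrence : ∀ (n : ℕ) {x : Fin (n + 1) → ℝ} {w : Fin n → ℝ}, StrictMono x → StrictMono w →
    (∀ k : Fin n, x k.castSucc < w k ∧ w k < x k.succ) →
    ∃ (a b : ℕ → ℝ) (q : ℕ → ℝ[X]), q 0 = 1 ∧ q 1 = Polynomial.X - C (a 0) ∧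
      (∀ k, q (k + 2) = (Polynomial.X - C (a (k + 1))) * q (k + 1) - C (b (k + 1)) * q k) ∧ (∀ j, 0 < b j) ∧
      q n = ∏ k, (Polynomial.X - C (w k)) ∧ q (n + 1) = ∏ i, (Polynomial.X - C (x i)) := by
  intro n
  induction n with
  | zero =>
    intro x w _ _ _
    obtain ⟨Q, hQ0, hQ1, hQrec⟩ := exists_recurrence_solution (fun _ => x 0) (fun _ => 1) 1 (Polynomial.X - C (x 0))
    refine ⟨fun _ => x 0, fun _ => 1, Q, hQ0, hQ1, hQrec, fun _ => one_pos, ?_, ?_⟩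
    · rw [hQ0]; exact (Finset.prod_empty).symm
    · show Q 1 = _
      rw [hQ1]
      exact (Fin.prod_univ_one fun i => Polynomial.X - C (x i)).symm
  | succ n ih =>
    intro x w hx hw hint
    obtain ⟨a', b', v, hb', hv, hvw, hfac⟩ := wendroff_step hx hw hint
    obtain ⟨a, b, q, hq0, hq1, hrec, hb, hqn, hqn1⟩ := ih hw hv hvw
    obtain ⟨A, B, Q, hQ0, hQ1, hQrec, hBj, hBN, hagree, htop⟩ := recurrence_modify_top hq0 hq1 hrec n a' b'
    refine ⟨A, B, Q, hQ0, hQ1, hQrec, fun j => ?_, ?_, ?_⟩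
    · by_cases hj : j = n + 1
      · rw [hj, hBN]; exact hb'
      · rw [hBj j hj]; exact hb j
    · rw [hagree (n + 1) le_rfl, hqn1]
    · show Q (n + 2) = _
      rw [htop, hqn1, hqn, hfac]

/-- **Wendroff's theorem in the sizes of N282** (`x : Fin (n+2)`, `w : Fin (n+1)`): a positive recurrence with `q_{n+1} = ∏_k (X − w_k)` and `q_{n+2} = ∏_i (X − x_i)`.
[Wendroff 1961; this file, §1057] -/
theorem wendroff_recurrence_succ {n : ℕ} {x : Fin (n + 2) → ℝ} {w : Fin (n + 1) → ℝ} (hx : StrictMono x) (hw : StrictMono w)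
    (hint : ∀ k : Fin (n + 1), x k.castSucc < w k ∧ w k < x k.succ) :
    ∃ (a b : ℕ → ℝ) (q : ℕ → ℝ[X]), q 0 = 1 ∧ q 1 = Polynomial.X - C (a 0) ∧
      (∀ k, q (k + 2) = (Polynomial.X - C (a (k + 1))) * q (k + 1) - C (b (k + 1)) * q k) ∧ (∀ j, 0 < b j) ∧
      q (n + 1) = ∏ k, (Polynomial.X - C (w k)) ∧ q (n + 2) = ∏ i, (Polynomial.X - C (x i)) :=
  wendroff_recurrence (n + 1) hx hw hint

/-- **WENDROFF: interlacing point sets are the zeros of consecutive orthogonal polynomials of ONE positive measure.**  For `x_0 < w_0 < ⋯ < w_n < x_{n+1}` there are atoms `z_0 < ⋯ < z_{n+2}`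
and weights `μ_k > 0`, `Σ μ_k = 1`, such that `Σ_k μ_k (∏_j (X − w_j) · G)(z_k) = 0` for every `G` of degree `< n + 1` and `Σ_k μ_k (∏_i (X − x_i) · G)(z_k) = 0` for every `G` of degree
`< n + 2`. [Wendroff 1961; Favard 1935; Chihara I Thm 4.4 ∕ Ex. 5.10; this file, §1057] -/
theorem exists_orthogonality_measure_of_interlace {n : ℕ} {x : Fin (n + 2) → ℝ} {w : Fin (n + 1) → ℝ} (hx : StrictMono x) (hw : StrictMono w)
    (hint : ∀ k : Fin (n + 1), x k.castSucc < w k ∧ w k < x k.succ) :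
    ∃ z μ : Fin (n + 3) → ℝ, StrictMono z ∧ (∀ k, 0 < μ k) ∧ ∑ k, μ k = 1 ∧
      (∀ G : ℝ[X], G.natDegree < n + 1 → ∑ k, μ k * ((∏ j, (Polynomial.X - C (w j))) * G).eval (z k) = 0) ∧
      ∀ G : ℝ[X], G.natDegree < n + 2 → ∑ k, μ k * ((∏ i, (Polynomial.X - C (x i))) * G).eval (z k) = 0 := by
  obtain ⟨a, b, q, hq0, hq1, hrec, hb, hqn, hqn1⟩ := wendroff_recurrence_succ hx hw hint
  obtain ⟨z, μ, hz, -, hμ, hsum, hpair⟩ := favard_finite hq0 hq1 hrec hb (n + 2)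
  have hmd := fun d => recurrence_monic_natDegree hq0 hq1 hrec d
  -- pairwise orthogonality with `ℕ` indices up to `n + 2`
  have hpair' : ∀ i j, i ≤ n + 2 → j ≤ n + 2 → i ≠ j → ∑ l, μ l * ((q i).eval (z l) * (q j).eval (z l)) = 0 := fun i j hi hj hij => by
    have h := hpair ⟨i, by omega⟩ ⟨j, by omega⟩
    rw [if_neg (fun h' => hij (by simpa using congrArg Fin.val h'))] at h
    exact h
  have hlow : ∀ d, d ≤ n + 2 → ∀ G : ℝ[X], G.natDegree < d → ∑ l, μ l * (q d * G).eval (z l) = 0 := fun d hd G hG =>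
    orthogonal_lower_of_pairwise (fun d _ => (hmd d).1) (fun d _ => (hmd d).2) hpair' hd hG
  refine ⟨z, μ, hz, hμ, hsum, fun G hG => ?_, fun G hG => ?_⟩
  · rw [← hqn]; exact hlow (n + 1) (by omega) G hG
  · rw [← hqn1]; exact hlow (n + 2) le_rfl G hG

/-- **Every monic real polynomial with simple real zeros is an orthogonal polynomial**: for `x_0 < ⋯ < x_n` there is a positive recurrence with `q_{n+1} = ∏_i (X − x_i)` (take the
midpoints `(x_k + x_{k+1})/2` as the interlacing partner). [Wendroff 1961; Chihara I Ex. 5.10; this file, §1057] -/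
theorem exists_positive_recurrence_of_strictMono {n : ℕ} {x : Fin (n + 1) → ℝ} (hx : StrictMono x) :
    ∃ (a b : ℕ → ℝ) (q : ℕ → ℝ[X]), q 0 = 1 ∧ q 1 = Polynomial.X - C (a 0) ∧
      (∀ k, q (k + 2) = (Polynomial.X - C (a (k + 1))) * q (k + 1) - C (b (k + 1)) * q k) ∧ (∀ j, 0 < b j) ∧
      q (n + 1) = ∏ i, (Polynomial.X - C (x i)) := by
  set w : Fin n → ℝ := fun k => (x k.castSucc + x k.succ) / 2 with hw
  have hint : ∀ k : Fin n, x k.castSucc < w k ∧ w k < x k.succ := fun k => by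
    have h := hx (Fin.castSucc_lt_succ (i := k))
    constructor <;> · simp only [hw]; linarith
  have hwm : StrictMono w := fun i j hij => by
    have h1 : w i < x i.succ := (hint i).2
    have h2 : x j.castSucc < w j := (hint j).1
    have h3 : x i.succ ≤ x j.castSucc := hx.monotone (Fin.succ_le_castSucc_iff.2 hij)
    linarith
  obtain ⟨a, b, q, hq0, hq1, hrec, hb, -, hq⟩ := wendroff_recurrence n hx hwm hint
  exact ⟨a, b, q, hq0, hq1, hrec, hb, hq⟩

end Summit.Ventures.HSemireg.Wedge.HankelOuter
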